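import Summits.NavierStokesRegularity.NavierStokesRegularity.Theorems.ScalingDefectPeepholeDoorCoreLimit
import Literature.Analysis.FluidPDE.CylinderInversion

/-!
# ScalingDefectPeepholeDoorCorePoincare — door S30 «ScalingDefectPeepholeDoor» (nsreg-p1 g24 ROUND-28; v2 repair of
# 2026-08-28T07:08:42Z: datum = the VORTICITY defect), LEG Cω part 1ω: the compactness–Liouville step from a CURL residual

The v2 repair of door S30 replaces the velocity self-similarity defect `(−t)∂ₜu − ½u − ½(x·∇)u` by its curl, the
vorticity defect `∂ₛΩ` (pressure- and gauge-free).  In similarity variables the cut-off profiles `Fₙ` then solve Leray's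
profile system only up to a GRADIENT plus a residual `Eₙ` whose CURL is small — not the residual itself.  This file
reduces that situation to the landed part 1/3 (`exists_curl_small_of_approxLerayProfiles`, which wants a small residual)
by re-gauging the pressure with the segment (Poincaré) potential of the residual:

* `exists_hasFDerivAt_segmentPotential_curl` — APPROXIMATE POINCARÉ LEMMA on `ℝ³`: for a `C¹` field `G` the segment
  potential `Π(y) = ∫₀¹ ⟪G(ty), y⟫ dt` is differentiable at every `y₀`, and its derivative differs from `⟪G(y₀), ·⟫` by at
  most `6 ‖y₀‖ · sup_{t∈[0,1]} |curl G(t y₀)|` (differentiation under the integral sign exactly as in the tree's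
  `hasFDerivAt_segmentPotential`, then `d/dt ⟪tG(ty₀), h⟫ = ⟪G(ty₀), h⟫ + t⟪DG(ty₀)y₀, h⟫` and the antisymmetric part of
  `DG` against the curl, tree `abs_inner_fderiv_sub_le_curl`).  With `curl G ≡ 0` this is the Poincaré lemma.
* `exists_curl_small_of_approxLerayProfiles_curl` — the compactness–Liouville step with the hypothesis
  `‖curl(−ΔFₙ + ½Fₙ + ½(y·∇)Fₙ + (Fₙ·∇)Fₙ)‖ ≤ 1/(6(n+2)²)` on `B̄(0,m+1)` for `n ≥ m` and ANY `C²` gauge `Qₙ` (instead of the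
  residual `… + ∇Qₙ` itself being `≤ 1/(n+2)`): re-gauge `Qₙ ↦ Qₙ − Πₙ`, `Πₙ` the segment potential of the residual
  (`curl ∇Qₙ = 0`, tree `curl_gradient_eq_zero_holds`), and call part 1/3.

Pure real analysis + plumbing of tree lemmas; no statement of the door is declared here.  Door S30 is a regularity CRITERION
inside a HYPOTHETICAL local Type-I blow-up (item 0056 `NoTypeII` stays OPEN); nothing here bears on NS regularity itself.
-/

noncomputable section

set_option linter.dupNamespace false

namespace Summit.NavierStokesRegularity.NavierStokesRegularity.Theorems.ScalingDefectPeepholeDoor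

open MeasureTheory Set Function Filter Metric TopologicalSpace InnerProductSpace intervalIntegral
open scoped ENNReal NNReal InnerProductSpace RealInnerProductSpace Laplacian Topology Interval
open Literature.Analysis Literature.Analysis.FluidPDE

-- nested operator types (`ℝ³ →L ℝ³ →L ℝ³`)
set_option maxSynthPendingDepth 3

/-- **Approximate Poincaré lemma (segment potential with a curl defect).**  For `G ∈ C¹(ℝ³; ℝ³)` and `y₀ ∈ ℝ³` the segment
potential `Π(y) = ∫₀¹ ⟪G(ty), y⟫ dt` has a Fréchet derivative `L` at `y₀`, and for every `ε ≥ 0` with `|curl G(t y₀)| ≤ ε` for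
`t ∈ [0,1]`: `‖L − ⟪G(y₀), ·⟫‖ ≤ 6 ε ‖y₀‖` (`(L − ⟪G(y₀),·⟫)h = ∫₀¹ t (⟪DG(ty₀)h, y₀⟫ − ⟪DG(ty₀)y₀, h⟫) dt` and
`|⟪DG h, y⟫ − ⟪DG y, h⟫| ≤ 6 |curl G| |h| |y|`).  [folklore; Poincaré lemma with the homotopy operator for 1-forms — proof
pattern of the tree's `hasFDerivAt_segmentPotential`] -/
theorem exists_hasFDerivAt_segmentPotential_curl
    {G : EuclideanSpace ℝ (Fin 3) → EuclideanSpace ℝ (Fin 3)} (hG : ContDiff ℝ 1 G) (y₀ : EuclideanSpace ℝ (Fin 3)) :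
    ∃ L : EuclideanSpace ℝ (Fin 3) →L[ℝ] ℝ,
      HasFDerivAt (fun y : EuclideanSpace ℝ (Fin 3) => ∫ t in (0 : ℝ)..1, ⟪G (t • y), y⟫) L y₀ ∧
      ∀ ε : ℝ, 0 ≤ ε → (∀ t ∈ Icc (0 : ℝ) 1, ‖curl G (t • y₀)‖ ≤ ε) →
        ‖L - InnerProductSpace.toDual ℝ (EuclideanSpace ℝ (Fin 3)) (G y₀)‖ ≤ 6 * ε * ‖y₀‖ := by
  have hGd : Differentiable ℝ G := hG.differentiable one_ne_zero
  have hGc : Continuous G := hG.continuous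
  have hDGc : Continuous (fderiv ℝ G) := hG.continuous_fderiv one_ne_zero
  -- the integrand and its derivative in `y`
  set F : EuclideanSpace ℝ (Fin 3) → ℝ → ℝ := fun y t => ⟪G (t • y), y⟫ with hF
  set F' : EuclideanSpace ℝ (Fin 3) → ℝ → EuclideanSpace ℝ (Fin 3) →L[ℝ] ℝ := fun y t =>
    t • (innerSL ℝ y).comp (fderiv ℝ G (t • y)) + innerSL ℝ (G (t • y)) with hF'
  have hdiff : ∀ t y, HasFDerivAt (fun y => F y t) (F' y t) y := by
    intro t y
    have h1 : HasFDerivAt (fun y : EuclideanSpace ℝ (Fin 3) => G (t • y))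
        ((fderiv ℝ G (t • y)).comp (t • ContinuousLinearMap.id ℝ (EuclideanSpace ℝ (Fin 3)))) y :=
      (hGd (t • y)).hasFDerivAt.comp y ((hasFDerivAt_id y).const_smul t)
    have h2 := h1.inner ℝ (hasFDerivAt_id y)
    refine h2.congr_fderiv ?_
    ext h
    simp only [hF', ContinuousLinearMap.coe_comp, Function.comp_apply, fderivInnerCLM_apply,
      ContinuousLinearMap.prod_apply, FunLike.coe_smul, Pi.smul_apply,
      ContinuousLinearMap.coe_id', id_eq, map_smul, _root_.add_apply, innerSL_apply_apply,
      smul_eq_mul, real_inner_smul_right, real_inner_comm]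
    ring
  -- continuity facts
  have hFc : ∀ y, Continuous fun t => F y t := fun y =>
    (hGc.comp (continuous_id.smul continuous_const)).inner continuous_const
  have hF'c : ∀ y, Continuous fun t => F' y t := by
    intro y
    refine ((continuous_id.smul (continuous_const.clm_comp
      (hDGc.comp (continuous_id.smul continuous_const))))).add ?_
    exact innerSL ℝ |>.continuous.comp (hGc.comp (continuous_id.smul continuous_const))
  -- a uniform bound on `ball y₀ 1 × [0,1]`
  obtain ⟨M₀, hM₀⟩ : ∃ M₀, ∀ z ∈ closedBall (0 : EuclideanSpace ℝ (Fin 3)) (‖y₀‖ + 1), ‖G z‖ ≤ M₀ :=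
    (isCompact_closedBall _ _).exists_bound_of_continuousOn hGc.continuousOn
  obtain ⟨M₁, hM₁⟩ : ∃ M₁, ∀ z ∈ closedBall (0 : EuclideanSpace ℝ (Fin 3)) (‖y₀‖ + 1), ‖fderiv ℝ G z‖ ≤ M₁ :=
    (isCompact_closedBall _ _).exists_bound_of_continuousOn hDGc.continuousOn
  have hmem : ∀ t ∈ Ι (0 : ℝ) 1, ∀ y ∈ ball y₀ 1,
      t • y ∈ closedBall (0 : EuclideanSpace ℝ (Fin 3)) (‖y₀‖ + 1) := by
    intro t ht y hy
    rw [uIoc_of_le zero_le_one] at ht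
    rw [mem_closedBall, dist_zero_right, norm_smul, Real.norm_of_nonneg ht.1.le]
    have hy' : ‖y‖ ≤ ‖y₀‖ + 1 := by
      rw [mem_ball] at hy
      have := norm_le_norm_add_norm_sub' y y₀
      rw [← dist_eq_norm] at this
      linarith
    calc t * ‖y‖ ≤ 1 * ‖y‖ := mul_le_mul_of_nonneg_right ht.2 (norm_nonneg _)
      _ ≤ ‖y₀‖ + 1 := by rw [one_mul]; exact hy'
  have hbound : ∀ᵐ t ∂(volume : Measure ℝ), t ∈ Ι (0 : ℝ) 1 → ∀ y ∈ ball y₀ 1,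
      ‖F' y t‖ ≤ (‖y₀‖ + 1) * M₁ + M₀ := by
    refine Eventually.of_forall fun t ht y hy => ?_
    have hty := hmem t ht y hy
    rw [uIoc_of_le zero_le_one] at ht
    have hy' : ‖y‖ ≤ ‖y₀‖ + 1 := by
      rw [mem_ball] at hy
      have := norm_le_norm_add_norm_sub' y y₀
      rw [← dist_eq_norm] at this
      linarith
    have hM1nn : 0 ≤ M₁ := (norm_nonneg _).trans (hM₁ _ hty)
    have hA : ‖t • (innerSL ℝ y).comp (fderiv ℝ G (t • y))‖ ≤ (‖y₀‖ + 1) * M₁ := by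
      rw [norm_smul, Real.norm_eq_abs, abs_of_nonneg ht.1.le]
      calc t * ‖(innerSL ℝ y).comp (fderiv ℝ G (t • y))‖
          ≤ 1 * ‖(innerSL ℝ y).comp (fderiv ℝ G (t • y))‖ :=
            mul_le_mul_of_nonneg_right ht.2 (norm_nonneg _)
        _ ≤ ‖innerSL ℝ y‖ * ‖fderiv ℝ G (t • y)‖ := by
            rw [one_mul]; exact ContinuousLinearMap.opNorm_comp_le _ _
        _ ≤ (‖y₀‖ + 1) * M₁ := by
            rw [innerSL_apply_norm]
            exact mul_le_mul hy' (hM₁ _ hty) (norm_nonneg _) (by positivity)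
    have hB : ‖innerSL ℝ (G (t • y))‖ ≤ M₀ := by
      rw [innerSL_apply_norm]; exact hM₀ _ hty
    exact (norm_add_le _ _).trans (add_le_add hA hB)
  have hkey := intervalIntegral.hasFDerivAt_integral_of_dominated_of_fderiv_le (μ := volume)
    (F := F) (F' := F') (x₀ := y₀) (a := 0) (b := 1) (s := ball y₀ 1) (bound := fun _ => (‖y₀‖ + 1) * M₁ + M₀)
    (ball_mem_nhds y₀ one_pos)
    (Eventually.of_forall fun y => (hFc y).aestronglyMeasurable)
    ((hFc y₀).intervalIntegrable 0 1)
    (hF'c y₀).aestronglyMeasurable hbound intervalIntegrable_const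
    (Eventually.of_forall fun t _ y _ => hdiff t y)
  refine ⟨∫ t in (0 : ℝ)..1, F' y₀ t, hkey, fun ε hε hcurl => ?_⟩
  -- the defect: `(L − ⟪G y₀, ·⟫) h = ∫₀¹ t (⟪DG(ty₀) h, y₀⟫ − ⟪DG(ty₀) y₀, h⟫) dt`
  refine ContinuousLinearMap.opNorm_le_bound _ (by positivity) fun h => ?_
  have hφc : Continuous fun t : ℝ => ⟪G (t • y₀), h⟫ + t * ⟪fderiv ℝ G (t • y₀) y₀, h⟫ :=
    ((hGc.comp (continuous_id.smul continuous_const)).inner continuous_const).add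
      (continuous_id.mul (((hDGc.comp (continuous_id.smul continuous_const)).clm_apply
        continuous_const).inner continuous_const))
  have hφ : ∀ t, HasDerivAt (fun t : ℝ => ⟪t • G (t • y₀), h⟫)
      (⟪G (t • y₀), h⟫ + t * ⟪fderiv ℝ G (t • y₀) y₀, h⟫) t := by
    intro t
    have h1 : HasDerivAt (fun t : ℝ => t • y₀) y₀ t := by simpa using (hasDerivAt_id t).smul_const y₀
    have h2 : HasDerivAt (fun t : ℝ => G (t • y₀)) (fderiv ℝ G (t • y₀) y₀) t :=
      (hGd (t • y₀)).hasFDerivAt.comp_hasDerivAt t h1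
    have h3 : HasDerivAt (fun t : ℝ => t • G (t • y₀)) (G (t • y₀) + t • fderiv ℝ G (t • y₀) y₀) t := by
      have := (hasDerivAt_id' t).smul h2
      refine this.congr_deriv ?_
      rw [one_smul, add_comm]
    have h4 := h3.inner ℝ (hasDerivAt_const t h)
    refine h4.congr_deriv ?_
    simp only [inner_zero_right, zero_add, inner_add_left, real_inner_smul_left]
  have hGh : ⟪G y₀, h⟫ = ∫ t in (0 : ℝ)..1, (⟪G (t • y₀), h⟫ + t * ⟪fderiv ℝ G (t • y₀) y₀, h⟫) := by
    rw [intervalIntegral.integral_eq_sub_of_hasDerivAt (fun t _ => hφ t) (hφc.intervalIntegrable 0 1)]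
    simp
  have hLh : (∫ t in (0 : ℝ)..1, F' y₀ t) h = ∫ t in (0 : ℝ)..1, F' y₀ t h :=
    ContinuousLinearMap.intervalIntegral_apply ((hF'c y₀).intervalIntegrable 0 1) h
  have hint : ∀ t, F' y₀ t h - (⟪G (t • y₀), h⟫ + t * ⟪fderiv ℝ G (t • y₀) y₀, h⟫) =
      t * (⟪fderiv ℝ G (t • y₀) h, y₀⟫ - ⟪fderiv ℝ G (t • y₀) y₀, h⟫) := by
    intro t
    simp only [hF', _root_.add_apply, FunLike.coe_smul, Pi.smul_apply, ContinuousLinearMap.coe_comp,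
      Function.comp_apply, innerSL_apply_apply, smul_eq_mul]
    rw [real_inner_comm (fderiv ℝ G (t • y₀) h) y₀]
    ring
  rw [FunLike.coe_sub, Pi.sub_apply, InnerProductSpace.toDual_apply_apply, hLh, hGh,
    ← intervalIntegral.integral_sub (((hF'c y₀).clm_apply continuous_const).intervalIntegrable 0 1)
      (hφc.intervalIntegrable 0 1)]
  simp_rw [hint]
  have hb : ∀ t ∈ Ι (0 : ℝ) 1,
      ‖t * (⟪fderiv ℝ G (t • y₀) h, y₀⟫ - ⟪fderiv ℝ G (t • y₀) y₀, h⟫)‖ ≤ 6 * ε * ‖y₀‖ * ‖h‖ := by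
    intro t ht
    rw [uIoc_of_le zero_le_one] at ht
    rw [norm_mul, Real.norm_of_nonneg ht.1.le, Real.norm_eq_abs]
    have h1 := abs_inner_fderiv_sub_le_curl G (t • y₀) h y₀
    have h2 := hcurl t ⟨ht.1.le, ht.2⟩
    have h3 : 6 * ‖curl G (t • y₀)‖ * ‖h‖ * ‖y₀‖ ≤ 6 * ε * ‖y₀‖ * ‖h‖ := by
      calc 6 * ‖curl G (t • y₀)‖ * ‖h‖ * ‖y₀‖ = ‖curl G (t • y₀)‖ * (6 * ‖h‖ * ‖y₀‖) := by ring
        _ ≤ ε * (6 * ‖h‖ * ‖y₀‖) := mul_le_mul_of_nonneg_right h2 (by positivity)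
        _ = 6 * ε * ‖y₀‖ * ‖h‖ := by ring
    calc t * |⟪fderiv ℝ G (t • y₀) h, y₀⟫ - ⟪fderiv ℝ G (t • y₀) y₀, h⟫|
        ≤ 1 * (6 * ‖curl G (t • y₀)‖ * ‖h‖ * ‖y₀‖) := mul_le_mul ht.2 h1 (abs_nonneg _) zero_le_one
      _ ≤ 6 * ε * ‖y₀‖ * ‖h‖ := by rw [one_mul]; exact h3
  have := intervalIntegral.norm_integral_le_of_norm_le_const hb
  rwa [sub_zero, abs_one, mul_one] at this

set_option maxHeartbeats 800000 in
/-- **Approximate Leray profiles with a CURL-small residual have small vorticity somewhere along the sequence** (v2 form of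
`exists_curl_small_of_approxLerayProfiles`): `C³` fields `Fₙ` with locally uniform `C³` bounds, the Type-I envelope
`|Fₙ(y)| ≤ C_u/(1+|y|)`, `div Fₙ = 0` on `B̄(0,m+1)` for `n ≥ m`, `C²` scalar fields `Qₙ` (any gauge), and the CURL of
the profile residual `Nₙ = −ΔFₙ + ½Fₙ + ½DFₙ(y)[y] + DFₙ(y)[Fₙ(y)]` small: `|curl Nₙ| ≤ 1/(6(n+2)²)` on `B̄(0,m+1)` for `n ≥ m`
(⇔ the same for `Eₙ = Nₙ + ∇Qₙ`): for every `θ, R > 0` some `Fₙ` has `∫_{B(0,2R)} |curl Fₙ|² ≤ θ²/4`.  Proof: re-gauge the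
pressure by the segment potential `Πₙ(y) = ∫₀¹⟪Eₙ(ty), y⟫dt` of the residual — by `exists_hasFDerivAt_segmentPotential_curl`
the new residual `Eₙ − ∇Πₙ` is `≤ 6·(m+1)/(6(n+2)²) ≤ 1/(n+2)` on `B̄(0,m+1)` — and apply
`exists_curl_small_of_approxLerayProfiles` with `Qₙ − Πₙ`.
[folklore plumbing; cite: PineauVicol2026 §9.3 (compactness variant), Tsai1998 Thm 1 via the tree] -/
theorem exists_curl_small_of_approxLerayProfiles_curl {Cu Kmax : ℝ} (hCu : 0 < Cu)
    (F : ℕ → EuclideanSpace ℝ (Fin 3) → EuclideanSpace ℝ (Fin 3)) (Qf : ℕ → EuclideanSpace ℝ (Fin 3) → ℝ)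
    (hF3 : ∀ n, ContDiff ℝ 3 (F n)) (hQ2 : ∀ n, ContDiff ℝ 2 (Qf n))
    (hbB : ∀ m n : ℕ, m ≤ n → ∀ y ∈ closedBall (0 : EuclideanSpace ℝ (Fin 3)) ((m : ℝ) + 1),
      ‖F n y‖ ≤ Kmax ∧ ‖fderiv ℝ (F n) y‖ ≤ Kmax ∧ ‖fderiv ℝ (fderiv ℝ (F n)) y‖ ≤ Kmax ∧
        ‖fderiv ℝ (fderiv ℝ (fderiv ℝ (F n))) y‖ ≤ Kmax)
    (hFI : ∀ n y, ‖F n y‖ ≤ Cu / (1 + ‖y‖))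
    (hdiv0 : ∀ m n : ℕ, m ≤ n → ∀ y ∈ closedBall (0 : EuclideanSpace ℝ (Fin 3)) ((m : ℝ) + 1),
      VectorCalculus.divergence (F n) y = 0)
    (hcurl : ∀ m n : ℕ, m ≤ n → ∀ y ∈ closedBall (0 : EuclideanSpace ℝ (Fin 3)) ((m : ℝ) + 1),
      ‖curl (fun z => -((Δ (F n)) z) + (1 / 2 : ℝ) • F n z + (1 / 2 : ℝ) • fderiv ℝ (F n) z z +
          convect (F n) (F n) z) y‖ ≤ 1 / (6 * ((n : ℝ) + 2) ^ 2)) :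
    ∀ θ : ℝ, 0 < θ → ∀ R : ℝ, 0 < R → ∃ n : ℕ,
      ∫⁻ y in ball (0 : EuclideanSpace ℝ (Fin 3)) (2 * R), ENNReal.ofReal (‖curl (F n) y‖ ^ 2) ≤
        ENNReal.ofReal (θ ^ 2 / 4) := by
  -- the profile residuals `Nₙ` and the full residual fields `Eₙ = Nₙ + ∇Qₙ`
  obtain ⟨N, hN⟩ : ∃ N : ℕ → EuclideanSpace ℝ (Fin 3) → EuclideanSpace ℝ (Fin 3), ∀ n, N n = fun z =>
      -((Δ (F n)) z) + (1 / 2 : ℝ) • F n z + (1 / 2 : ℝ) • fderiv ℝ (F n) z z + convect (F n) (F n) z :=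
    ⟨_, fun _ => rfl⟩
  obtain ⟨E, hE⟩ : ∃ E : ℕ → EuclideanSpace ℝ (Fin 3) → EuclideanSpace ℝ (Fin 3), ∀ n, E n = fun z =>
      N n z + gradient (Qf n) z := ⟨_, fun _ => rfl⟩
  -- `Nₙ, ∇Qₙ, Eₙ ∈ C¹`
  have hN1 : ∀ n, ContDiff ℝ 1 (N n) := by
    intro n
    have h2 : ContDiff ℝ 2 (fderiv ℝ (F n)) := (hF3 n).fderiv_right (m := 2) (by norm_num)
    have h1 : ContDiff ℝ 1 (fderiv ℝ (fderiv ℝ (F n))) := h2.fderiv_right (m := 1) (by norm_num)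
    have hF1 : ContDiff ℝ 1 (F n) := (hF3 n).of_le (by norm_num)
    have hDF1 : ContDiff ℝ 1 (fderiv ℝ (F n)) := h2.of_le (by norm_num)
    have hLap : ContDiff ℝ 1 (fun z => (Δ (F n)) z) := by
      have e : (fun z => (Δ (F n)) z) = fun z => ∑ i, fderiv ℝ (fderiv ℝ (F n)) z
          (EuclideanSpace.basisFun (Fin 3) ℝ i) (EuclideanSpace.basisFun (Fin 3) ℝ i) :=
        funext fun z => laplacian_apply_eq_sum_fderiv_fderiv_basisFun _ _
      rw [e]
      exact ContDiff.sum fun i _ => (h1.clm_apply contDiff_const).clm_apply contDiff_const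
    have hconv : ContDiff ℝ 1 (fun z => convect (F n) (F n) z) := hDF1.clm_apply hF1
    rw [hN n]
    exact ((hLap.neg.add (hF1.const_smul _)).add ((hDF1.clm_apply contDiff_id).const_smul _)).add hconv
  have hgrad1 : ∀ n, ContDiff ℝ 1 (fun z => gradient (Qf n) z) := fun n => by
    have hq : ContDiff ℝ 1 (fderiv ℝ (Qf n)) := (hQ2 n).fderiv_right (m := 1) (by norm_num)
    exact (InnerProductSpace.toDual ℝ (EuclideanSpace ℝ (Fin 3))).symm.contDiff.comp hq
  have hEy : ∀ n y, E n y = N n y + gradient (Qf n) y := fun n y => by rw [hE n]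
  have hNy : ∀ n y, N n y =
      -((Δ (F n)) y) + (1 / 2 : ℝ) • F n y + (1 / 2 : ℝ) • fderiv ℝ (F n) y y + convect (F n) (F n) y :=
    fun n y => by rw [hN n]
  have hE1 : ∀ n, ContDiff ℝ 1 (E n) := fun n => by
    rw [hE n]
    exact (hN1 n).add (hgrad1 n)
  -- `curl Eₙ = curl Nₙ` (`curl ∇Qₙ = 0`)
  have hcurlE : ∀ n w, curl (E n) w = curl (N n) w := by
    intro n w
    have hadd : HasFDerivAt (fun z => N n z + gradient (Qf n) z)
        (fderiv ℝ (N n) w + fderiv ℝ (fun z => gradient (Qf n) z) w) w :=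
      (((hN1 n).differentiable (by norm_num)) w).hasFDerivAt.add
        (((hgrad1 n).differentiable (by norm_num)) w).hasFDerivAt
    rw [hE n, curl_eq_curlCLM, curl_eq_curlCLM, hadd.fderiv, map_add,
      ← curl_eq_curlCLM (fun z => gradient (Qf n) z) w]
    have h0 : curl (fun z => gradient (Qf n) z) w = 0 := curl_gradient_eq_zero_holds (Qf n) (hQ2 n) w
    rw [h0, add_zero]
  -- the segment potentials of the residuals and the re-gauged pressures
  choose L hL hLb using fun n y => exists_hasFDerivAt_segmentPotential_curl (hE1 n) y
  set Qf' : ℕ → EuclideanSpace ℝ (Fin 3) → ℝ := fun n y =>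
    Qf n y - ∫ t in (0 : ℝ)..1, ⟪E n (t • y), y⟫ with hQf'
  have hQd : ∀ n, Differentiable ℝ (Qf n) := fun n => (hQ2 n).differentiable (by norm_num)
  have hQd' : ∀ n, Differentiable ℝ (Qf' n) := fun n y =>
    ((hQd n) y).sub (hL n y).differentiableAt
  have hgrad' : ∀ n y, gradient (Qf' n) y =
      gradient (Qf n) y - (InnerProductSpace.toDual ℝ (EuclideanSpace ℝ (Fin 3))).symm (L n y) := by
    intro n y
    have h1 : HasFDerivAt (Qf' n) (fderiv ℝ (Qf n) y - L n y) y :=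
      ((hQd n) y).hasFDerivAt.sub (hL n y)
    unfold gradient
    rw [h1.fderiv, map_sub]
  -- the re-gauged residual is small on `B̄(0, m+1)` for `n ≥ m`
  have hEq : ∀ m n : ℕ, m ≤ n → ∀ y ∈ closedBall (0 : EuclideanSpace ℝ (Fin 3)) ((m : ℝ) + 1),
      ‖-((Δ (F n)) y) + (1 / 2 : ℝ) • F n y + (1 / 2 : ℝ) • fderiv ℝ (F n) y y + convect (F n) (F n) y +
          gradient (Qf' n) y‖ ≤ 1 / ((n : ℝ) + 2) := by
    intro m n hmn y hy
    have hy' : ‖y‖ ≤ (m : ℝ) + 1 := mem_closedBall_zero_iff.1 hy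
    have hmn' : (m : ℝ) ≤ n := by exact_mod_cast hmn
    have hn2 : (0 : ℝ) < (n : ℝ) + 2 := by positivity
    -- the curl of the residual along the segment `[0, y] ⊆ B̄(0, m+1)`
    have hseg : ∀ t ∈ Icc (0 : ℝ) 1, ‖curl (E n) (t • y)‖ ≤ 1 / (6 * ((n : ℝ) + 2) ^ 2) := by
      intro t ht
      rw [hcurlE n, hN n]
      refine hcurl m n hmn (t • y) ?_
      rw [mem_closedBall_zero_iff, norm_smul, Real.norm_of_nonneg ht.1]
      calc t * ‖y‖ ≤ 1 * ‖y‖ := mul_le_mul_of_nonneg_right ht.2 (norm_nonneg _)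
        _ ≤ (m : ℝ) + 1 := by rw [one_mul]; exact hy'
    have hdef := hLb n y (1 / (6 * ((n : ℝ) + 2) ^ 2)) (by positivity) hseg
    have e1 : -((Δ (F n)) y) + (1 / 2 : ℝ) • F n y + (1 / 2 : ℝ) • fderiv ℝ (F n) y y + convect (F n) (F n) y +
        gradient (Qf' n) y =
        E n y - (InnerProductSpace.toDual ℝ (EuclideanSpace ℝ (Fin 3))).symm (L n y) := by
      rw [hgrad' n y, hEy, hNy]
      abel
    have e2 : E n y - (InnerProductSpace.toDual ℝ (EuclideanSpace ℝ (Fin 3))).symm (L n y) =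
        (InnerProductSpace.toDual ℝ (EuclideanSpace ℝ (Fin 3))).symm
          (InnerProductSpace.toDual ℝ (EuclideanSpace ℝ (Fin 3)) (E n y) - L n y) := by
      rw [map_sub, LinearIsometryEquiv.symm_apply_apply]
    rw [e1, e2, LinearIsometryEquiv.norm_map, ← norm_neg, neg_sub]
    calc ‖L n y - InnerProductSpace.toDual ℝ (EuclideanSpace ℝ (Fin 3)) (E n y)‖
        ≤ 6 * (1 / (6 * ((n : ℝ) + 2) ^ 2)) * ‖y‖ := hdef
      _ = ‖y‖ / ((n : ℝ) + 2) ^ 2 := by field_simp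
      _ ≤ ((n : ℝ) + 2) / ((n : ℝ) + 2) ^ 2 := by gcongr; linarith
      _ = 1 / ((n : ℝ) + 2) := by field_simp
  exact exists_curl_small_of_approxLerayProfiles hCu F Qf' hF3 hQd' hbB hFI hdiv0 hEq

end Summit.NavierStokesRegularity.NavierStokesRegularity.Theorems.ScalingDefectPeepholeDoor

end
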